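import Literature.Analysis.SegalBargmann.SchwartzCarrierTransport
import Literature.Analysis.SegalBargmann.HermiteMultiplierDerivative
import HarnessLib

/-!
# The Heisenberg-covariant torus on `𝓢(ℝⁿ)` IS the oscillator torus `e^{iθ·N}` (Folland 1989, §1.7, Prop. (4.39))

Topic `Analysis/SegalBargmann`; namespace `Literature.Analysis.SegalBargmann`.  JUNCTION of three landed lanes: the
`L²` RIGIDITY lane (`SchrodingerCompactRigidity`, `SchrodingerSchwartzBridge`, `SchwartzCarrierTransport`: a family
Heisenberg-covariant over `ι : H → U(σ)` acts on `L²(ℝ^σ)` by `vacCoeff • μ₀(ι h)`; `μ₀(diag t) hermiteL2 β = torusChar β t •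
hermiteL2 β`; Schwartz-level families enter through `toL2`, `LiftsTo`, `IsRhoCovariantS`), the SCHWARTZ-LEVEL oscillator
torus (`HermiteOscillatorTorus`: `torusOpCLM θ = e^{iθ·N}` on `𝓢(EuclideanSpace ℝ σ, ℂ)`, `e^{iθ·N} h_α = e^{iθ·α} h_α`) and its
analysis (`HermiteMultiplierStrongContinuity`, `HermiteMultiplierDerivative`).  Proved here (Mathlib + the imported tree
files only; no cited statement is a hypothesis):

* §1 the carrier junction `euclE : EuclideanSpace ℝ σ ≃L[ℝ] (σ → ℝ)` (volume preserving) and the Hermite functions as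
  Schwartz maps on the Folland carrier, `hermitePi α`, with **`toL2 (hermitePi α) = hermiteL2 α`** (`toL2_hermitePi`);
* §2 **continuous linear maps out of `𝓢` are determined by their values on the Hermite functions**
  (`clm_eq_of_eq_on_herm`, `clm_eq_of_eq_on_hermitePi`: density of the Hermite span IN THE SCHWARTZ TOPOLOGY);
* §3 the torus on the Folland carrier `torusOpPi θ` and the torus point `torusPt θ = (e^{−iθ_l})_l ∈ U(1)^σ` with
  `torusChar β (torusPt θ) = e^{iθ·β}`; **the Schwartz-level torus LIFTS to the `L²` torus of the rigidity lane**: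
  `toL2 (torusOpPi θ f) = schrodingerU (diagHom (torusPt θ)) (toL2 f)` (`toL2_torusOpPi`, `liftsTo_torusOpPi`);
* §4 **RIGIDITY ON `𝓢`**: for ANY Schwartz-level family `ωS` covariant over `ι : H → U(σ)` with unitary lifts and any `h`
  with `ι h = diagHom (torusPt θ)`: `ωS h f = vacCoeff ω h • torusOpPi θ f` for EVERY `f ∈ 𝓢(ℝ^σ)`
  (`IsRhoCovariantS.apply_eq_vacCoeff_smul_torusOpPi`; no Schwartz continuity of `ωS h` assumed), hence
  `ωS h (hermitePi α) = (vacCoeff ω h · e^{iθ·α}) • hermitePi α`; every torus element is reached (`torusPt_torusAngle`);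
* §5 transported analysis: strong/joint continuity of `θ ↦ torusOpPi θ f` and the slope limits at `0` IN `𝓢`.

Use (pub-hodgecm model cell): an archimedean Weil-representation term typed on a Schwartz space is Heisenberg-covariant by
construction; by §4 its compact torus IS `e^{iθ·N}` up to the vacuum character, so the printed torus weights on Fock
vectors (binder rows A12/A34, field `omg_ins`) and the Schwartz continuity / differentiability along the torus are tree
theorems, with only the VALUE of the vacuum character left to the printed records.

## References

* [Folland1989] G. B. Folland, *Harmonic Analysis in Phase Space*, Annals of Mathematics Studies 122, Princeton UP
  (1989), §1.7 (Hermite functions, (1.83)), §4.2 (4.23) and the Schur remark following it, Prop. (4.39)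
  (`μ(U) = B⁻¹ ν(U) B` on `U(n)`).  [cite: Folland1989, Prop (4.39)]
* M. Reed, B. Simon, *Methods of Modern Mathematical Physics I*, Theorem V.13 (the `N`-representation of `𝒮`).

## Provenance

LEAN-IN-TREE rule (2026-08-18), pub-hodgecm model-construction sub-cell, seat mc-binder-2 gen 2 (closes the lane hand-off
item "Schwartz–Hermite ↔ `hermiteL2` junction; `torusOpCLM` = `schrodingerU ∘ diagHom` on `𝓢`").
-/

set_option autoImplicit false

noncomputable section

open MeasureTheory Complex SchwartzMap Filter Topology
open scoped InnerProductSpace ComplexConjugate Real BigOperators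

namespace Literature.Analysis.SegalBargmann

variable {σ : Type*} [Fintype σ] [DecidableEq σ]

local notation "L2R" σ => Lp ℂ 2 (volume : Measure (σ → ℝ))
local notation "SR" σ => SchwartzMap (σ → ℝ) ℂ
local notation "SE" σ => SchwartzMap (EuclideanSpace ℝ σ) ℂ

/-! ## §1  The Euclidean carrier and the Hermite functions on the Folland carrier -/

section Carrier

variable (σ) in
/-- **The carrier junction** `EuclideanSpace ℝ σ ≃L[ℝ] (σ → ℝ)` (Mathlib `EuclideanSpace.equiv`). [folklore] -/
abbrev euclE : EuclideanSpace ℝ σ ≃L[ℝ] (σ → ℝ) := EuclideanSpace.equiv σ ℝ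

omit [Fintype σ] [DecidableEq σ] in
/-- `euclE σ x = x` as functions. [folklore] -/
@[simp] theorem euclE_apply (x : EuclideanSpace ℝ σ) : euclE σ x = (⇑x : σ → ℝ) := rfl

omit [Fintype σ] [DecidableEq σ] in
/-- `(euclE σ)⁻¹ y = y` as functions. [folklore] -/
@[simp] theorem coe_euclE_symm_apply (y : σ → ℝ) : (⇑((euclE σ).symm y) : σ → ℝ) = y := rfl

omit [DecidableEq σ] in
/-- `(euclE σ)⁻¹ = toLp 2` is volume preserving (Mathlib `PiLp.volume_preserving_toLp`). [folklore] -/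
theorem measurePreserving_euclE_symm :
    MeasurePreserving ((euclE σ).symm) (volume : Measure (σ → ℝ)) (volume : Measure (EuclideanSpace ℝ σ)) :=
  PiLp.volume_preserving_toLp σ

omit [DecidableEq σ] in
/-- `euclE σ = ofLp` is volume preserving (Mathlib `PiLp.volume_preserving_ofLp`). [folklore] -/
theorem measurePreserving_euclE :
    MeasurePreserving (euclE σ) (volume : Measure (EuclideanSpace ℝ σ)) (volume : Measure (σ → ℝ)) :=
  PiLp.volume_preserving_ofLp σ

/-- **The Hermite function `h_α` as a Schwartz map on the Folland carrier `σ → ℝ`**: the transport of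
`hermiteSchwartz (herm α)` along `euclE`. [cite: Folland1989, §1.7] -/
def hermitePi (α : σ →₀ ℕ) : SR σ := schwartzTransport (euclE σ) (hermiteSchwartz (herm α))

/-- Pointwise: `hermitePi α x = h_α(x) = herm α (x) e^{−π|x|²}`. [cite: Folland1989, §1.7] -/
@[simp] theorem hermitePi_apply (α : σ →₀ ℕ) (x : σ → ℝ) : hermitePi α x = hermiteFun (herm α) x := by
  rw [hermitePi, schwartzTransport_apply, hermiteSchwartz_apply, coe_euclE_symm_apply]

/-- `(schwartzTransport euclE)⁻¹ (hermitePi α) = hermiteSchwartz (herm α)`. [folklore] -/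
@[simp] theorem schwartzTransport_symm_hermitePi (α : σ →₀ ℕ) :
    (schwartzTransport (euclE σ)).symm (hermitePi α) = hermiteSchwartz (herm α) :=
  (schwartzTransport (euclE σ)).symm_apply_apply _

/-- `schwartzTransport euclE (hermiteSchwartz (herm α)) = hermitePi α`. [folklore] -/
theorem schwartzTransport_hermiteSchwartz (α : σ →₀ ℕ) :
    schwartzTransport (euclE σ) (hermiteSchwartz (herm α)) = hermitePi α := rfl

/-- **The `toL2` junction: the Schwartz-map Hermite function IS the `L²` Hermite vector of the Fock lane**,
`toL2 (hermitePi α) = hermiteL2 α`. [cite: Folland1989, §1.7] -/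
theorem toL2_hermitePi (α : σ →₀ ℕ) : toL2 (hermitePi α) = (hermiteL2 α : L2R σ) := by
  apply Lp.ext
  filter_upwards [coeFn_toL2 (hermitePi α), hermiteL2_coeFn α] with x h1 h2
  rw [h1, h2, hermitePi_apply]

/-- The same through the `L²` transport of the Euclidean carrier:
`(toL2D (hermiteSchwartz (herm α))) ∘ euclE⁻¹ = hermiteL2 α`. [folklore] -/
theorem l2Transport_toL2D_hermiteSchwartz (α : σ →₀ ℕ) :
    l2Transport (euclE σ) measurePreserving_euclE_symm
        (toL2D (volume : Measure (EuclideanSpace ℝ σ)) (hermiteSchwartz (herm α))) = (hermiteL2 α : L2R σ) := by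
  rw [← toL2_schwartzTransport (euclE σ) measurePreserving_euclE_symm, schwartzTransport_hermiteSchwartz,
    toL2_hermitePi]

end Carrier

/-! ## §2  Continuous linear maps out of `𝓢` are determined on the Hermite functions -/

section Ext

variable {Y : Type*} [AddCommMonoid Y] [Module ℂ Y] [TopologicalSpace Y] [T2Space Y]

/-- **Density of the Hermite span in the Schwartz topology, operator form**: two continuous linear maps
`𝓢(EuclideanSpace ℝ σ, ℂ) → Y` into a Hausdorff space that agree on every `h_β` are equal (each `f` is the sum IN `𝓢`
of its Hermite series, `hasSum_hermiteCoeff_smul_herm`). [cite: Folland1989, §1.7] -/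
theorem clm_eq_of_eq_on_herm {S T : (SE σ) →L[ℂ] Y}
    (h : ∀ β : σ →₀ ℕ, S (hermiteSchwartz (herm β)) = T (hermiteSchwartz (herm β))) : S = T := by
  refine ContinuousLinearMap.ext fun f => ?_
  have hS := (hasSum_hermiteCoeff_smul_herm f).mapL S
  have hT := (hasSum_hermiteCoeff_smul_herm f).mapL T
  have hfun : (fun β : σ →₀ ℕ => S (hermiteCoeff β f • hermiteSchwartz (herm β))) =
      fun β => T (hermiteCoeff β f • hermiteSchwartz (herm β)) := by
    funext β
    rw [map_smul, map_smul, h β]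
  rw [hfun] at hS
  exact hS.unique hT

/-- The same on the Folland carrier: continuous linear maps `𝓢(ℝ^σ, ℂ) → Y` agreeing on every `hermitePi β` are equal.
[cite: Folland1989, §1.7] -/
theorem clm_eq_of_eq_on_hermitePi {S T : (SR σ) →L[ℂ] Y}
    (h : ∀ β : σ →₀ ℕ, S (hermitePi β) = T (hermitePi β)) : S = T := by
  have h' : S.comp (schwartzTransport (euclE σ) : (SE σ) →L[ℂ] SR σ) =
      T.comp (schwartzTransport (euclE σ) : (SE σ) →L[ℂ] SR σ) :=
    clm_eq_of_eq_on_herm fun β => by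
      simp only [ContinuousLinearMap.comp_apply, ContinuousLinearEquiv.coe_coe, schwartzTransport_hermiteSchwartz, h β]
  refine ContinuousLinearMap.ext fun f => ?_
  have h2 := congrArg (fun R : (SE σ) →L[ℂ] Y => R ((schwartzTransport (euclE σ)).symm f)) h'
  simpa only [ContinuousLinearMap.comp_apply, ContinuousLinearEquiv.coe_coe, ContinuousLinearEquiv.apply_symm_apply]
    using h2

/-- **The Hermite expansion on the Folland carrier**: `f = Σ_β c_β h_β` IN `𝓢(ℝ^σ, ℂ)`, with the coefficients of the
transported function. [cite: Folland1989, §1.7] -/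
theorem hasSum_hermiteCoeff_smul_hermitePi (f : SR σ) :
    HasSum (fun β : σ →₀ ℕ => hermiteCoeff β ((schwartzTransport (euclE σ)).symm f) • hermitePi β) f := by
  have h := (hasSum_hermiteCoeff_smul_herm ((schwartzTransport (euclE σ)).symm f)).mapL
    (schwartzTransport (euclE σ) : (SE σ) →L[ℂ] SR σ)
  simpa only [ContinuousLinearEquiv.coe_coe, map_smul, ContinuousLinearEquiv.apply_symm_apply,
    schwartzTransport_hermiteSchwartz] using h

end Ext

/-! ## §3  The torus on the Folland carrier and its `L²` lift -/

section Torus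

/-- **The torus point of the angle `θ ∈ ℝ^σ`**: `torusPt θ = (e^{−iθ_l})_l ∈ U(1)^σ` — the sign is the one for which
`μ₀(diag (torusPt θ))` is `e^{+iθ·N}` (the Fock action of the tree is `ν(U)F = F ∘ U⁻¹`). [folklore] -/
def torusPt (θ : σ → ℝ) : σ → Circle := fun l => Circle.exp (-θ l)

omit [Fintype σ] [DecidableEq σ] in
/-- `conj (e^{−iθ_l}) = e^{iθ_l}`. [folklore] -/
theorem conj_coe_torusPt (θ : σ → ℝ) (l : σ) :
    conj ((torusPt θ l : Circle) : ℂ) = Complex.exp ((θ l : ℂ) * I) := by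
  rw [torusPt, Circle.exp_neg, Circle.coe_inv_eq_conj, Complex.conj_conj, Circle.coe_exp]

omit [DecidableEq σ] in
/-- **`torusChar β (torusPt θ) = e^{iθ·β}`**: the weight of the rigidity lane at the torus point of `θ` is the phase of
the oscillator torus. [folklore] -/
theorem torusChar_torusPt (β : σ →₀ ℕ) (θ : σ → ℝ) : torusChar β (torusPt θ) = torusPhase θ β := by
  rw [torusChar, torusPhase]
  simp_rw [conj_coe_torusPt, ← Complex.exp_nat_mul, ← Complex.exp_sum]
  congr 1
  push_cast
  rw [Finset.sum_mul]
  refine Finset.sum_congr rfl fun l _ => ?_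
  ring

/-- **The angle of a torus element**: `torusAngle t = (−arg t_l)_l`, a section of `torusPt`. [folklore] -/
def torusAngle (t : σ → Circle) : σ → ℝ := fun l => -Complex.arg ((t l : Circle) : ℂ)

omit [Fintype σ] [DecidableEq σ] in
/-- `torusPt (torusAngle t) = t`: every torus element is a torus point. [folklore] -/
@[simp] theorem torusPt_torusAngle (t : σ → Circle) : torusPt (torusAngle t) = t := by
  funext l
  rw [torusPt, torusAngle, neg_neg, Circle.exp_arg]

/-- **The oscillator torus on the Folland carrier** `torusOpPi θ := e^* ∘ e^{iθ·N} ∘ (e^*)⁻¹ : 𝓢(ℝ^σ, ℂ) →L[ℂ] 𝓢(ℝ^σ, ℂ)`.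
[cite: Folland1989, §1.7] -/
def torusOpPi (θ : σ → ℝ) : (SR σ) →L[ℂ] SR σ :=
  (schwartzTransport (euclE σ) : (SE σ) →L[ℂ] SR σ).comp
    ((torusOpCLM θ).comp ((schwartzTransport (euclE σ)).symm : (SR σ) →L[ℂ] SE σ))

/-- Unfolding. [folklore] -/
theorem torusOpPi_apply (θ : σ → ℝ) (f : SR σ) :
    torusOpPi θ f = schwartzTransport (euclE σ) (torusOpCLM θ ((schwartzTransport (euclE σ)).symm f)) := rfl

/-- `torusOpPi θ` is the transport `opTransport euclE (torusOpCLM θ)` of the carrier-transport file. [folklore] -/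
theorem coe_torusOpPi (θ : σ → ℝ) :
    (torusOpPi θ : (SR σ) →ₗ[ℂ] SR σ) = opTransport (euclE σ) (torusOpCLM θ : (SE σ) →ₗ[ℂ] SE σ) :=
  LinearMap.ext fun _ => rfl

/-- **`torusOpPi θ h_α = e^{iθ·α} h_α`.** [cite: Folland1989, §1.7] -/
theorem torusOpPi_hermitePi (θ : σ → ℝ) (α : σ →₀ ℕ) :
    torusOpPi θ (hermitePi α) = torusPhase θ α • hermitePi α := by
  rw [torusOpPi_apply, schwartzTransport_symm_hermitePi, torusOpCLM_herm, map_smul, schwartzTransport_hermiteSchwartz]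

/-- `torusOpPi 0 = 1`. [folklore] -/
theorem torusOpPi_zero : torusOpPi (0 : σ → ℝ) = ContinuousLinearMap.id ℂ (SR σ) := by
  refine ContinuousLinearMap.ext fun f => ?_
  rw [torusOpPi_apply, torusOpCLM_zero, ContinuousLinearMap.id_apply, ContinuousLinearMap.id_apply,
    ContinuousLinearEquiv.apply_symm_apply]

/-- The group law `torusOpPi (θ + θ') = torusOpPi θ ∘ torusOpPi θ'`. [cite: Folland1989, §1.7] -/
theorem torusOpPi_add (θ θ' : σ → ℝ) : torusOpPi (θ + θ') = (torusOpPi θ).comp (torusOpPi θ') := by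
  refine ContinuousLinearMap.ext fun f => ?_
  rw [torusOpPi_apply, torusOpCLM_add, ContinuousLinearMap.comp_apply, ContinuousLinearMap.comp_apply,
    torusOpPi_apply, torusOpPi_apply, ContinuousLinearEquiv.symm_apply_apply]

/-- **The Schwartz-level torus lifts to the `L²` torus of the rigidity lane**:
`toL2 (e^{iθ·N} f) = μ₀(diag (torusPt θ)) (toL2 f)` for every `f ∈ 𝓢(ℝ^σ)` — both sides are continuous linear in `f`
and agree on the Hermite functions (`torusOpPi_hermitePi`, `schrodingerU_diagHom_hermiteL2`, `torusChar_torusPt`).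
[cite: Folland1989, Prop (4.39)] -/
theorem toL2_torusOpPi (θ : σ → ℝ) (f : SR σ) :
    toL2 (torusOpPi θ f) = schrodingerU (diagHom (torusPt θ)) (toL2 f) := by
  have h : (toL2 : (SR σ) →L[ℂ] L2R σ).comp (torusOpPi θ) =
      (((schrodingerU (diagHom (torusPt θ))).toContinuousLinearEquiv : (L2R σ) ≃L[ℂ] L2R σ) :
        (L2R σ) →L[ℂ] L2R σ).comp toL2 :=
    clm_eq_of_eq_on_hermitePi fun β => by
      rw [ContinuousLinearMap.comp_apply, ContinuousLinearMap.comp_apply, torusOpPi_hermitePi, map_smul,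
        toL2_hermitePi, ContinuousLinearEquiv.coe_coe, LinearIsometryEquiv.coe_toContinuousLinearEquiv,
        schrodingerU_diagHom_hermiteL2, torusChar_torusPt]
  have h2 := congrArg (fun R : (SR σ) →L[ℂ] L2R σ => R f) h
  simpa only [ContinuousLinearMap.comp_apply, ContinuousLinearEquiv.coe_coe,
    LinearIsometryEquiv.coe_toContinuousLinearEquiv] using h2

/-- `LiftsTo` form of `toL2_torusOpPi`: `e^{iθ·N}` on `𝓢(ℝ^σ)` is the restriction of the unitary `μ₀(diag (torusPt θ))`.
[cite: Folland1989, Prop (4.39)] -/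
theorem liftsTo_torusOpPi (θ : σ → ℝ) :
    LiftsTo (torusOpPi θ : (SR σ) →ₗ[ℂ] SR σ)
      (((schrodingerU (diagHom (torusPt θ))).toContinuousLinearEquiv : (L2R σ) ≃L[ℂ] L2R σ) :
        (L2R σ) →L[ℂ] L2R σ) :=
  fun f => toL2_torusOpPi θ f

/-- The Euclidean-carrier form: `(toL2D (e^{iθ·N} g)) ∘ euclE⁻¹ = μ₀(diag (torusPt θ)) ((toL2D g) ∘ euclE⁻¹)` for
`g ∈ 𝓢(EuclideanSpace ℝ σ, ℂ)`. [cite: Folland1989, Prop (4.39)] -/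
theorem l2Transport_toL2D_torusOpCLM (θ : σ → ℝ) (g : SE σ) :
    l2Transport (euclE σ) measurePreserving_euclE_symm (toL2D volume (torusOpCLM θ g)) =
      schrodingerU (diagHom (torusPt θ))
        (l2Transport (euclE σ) measurePreserving_euclE_symm (toL2D volume g)) := by
  rw [← toL2_schwartzTransport (euclE σ) measurePreserving_euclE_symm,
    ← toL2_schwartzTransport (euclE σ) measurePreserving_euclE_symm, ← toL2_torusOpPi, torusOpPi_apply,
    ContinuousLinearEquiv.symm_apply_apply]

end Torus

/-! ## §4  Rigidity on `𝓢`: a covariant family on the torus IS `e^{iθ·N}` up to the vacuum character -/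

section Rigidity

variable {H : Type*} {ι : H → Matrix.unitaryGroup σ ℂ} {ωS : H → ((SR σ) →ₗ[ℂ] SR σ)}
  {ω : H → ((L2R σ) ≃ₗᵢ[ℂ] L2R σ)}

/-- **Rigidity on Schwartz space, torus form.**  Let `ωS` be a family of linear operators on `𝓢(ℝ^σ)` that is
Heisenberg-covariant over `ι : H → U(σ)` and lifts to unitaries `ω h` on `L²`.  If `ι h` is the torus element
`diag (torusPt θ)`, then `ωS h = vacCoeff ω h • e^{iθ·N}` ON ALL OF `𝓢(ℝ^σ)`:
`ωS h f = vacCoeff ω h • torusOpPi θ f`.  (No continuity of `ωS h` in the Schwartz topology is assumed: both sides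
embed injectively into `L²`, where the identity is `IsRhoCovariantS.toL2_apply` + `toL2_torusOpPi`.)
[cite: Folland1989, Prop (4.39)] -/
theorem IsRhoCovariantS.apply_eq_vacCoeff_smul_torusOpPi (hS : IsRhoCovariantS ι ωS)
    (hlift : ∀ h, LiftsTo (ωS h) (liftCLM ω h)) {h : H} {θ : σ → ℝ} (ht : ι h = diagHom (torusPt θ)) (f : SR σ) :
    ωS h f = vacCoeff ω h • torusOpPi θ f := by
  apply toL2_injective
  rw [hS.toL2_apply hlift, ht, map_smul, toL2_torusOpPi]

/-- The same for an arbitrary torus element `ι h = diag t`, with the angle `torusAngle t`. [cite: Folland1989, Prop (4.39)] -/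
theorem IsRhoCovariantS.apply_eq_vacCoeff_smul_torusOpPi_torusAngle (hS : IsRhoCovariantS ι ωS)
    (hlift : ∀ h, LiftsTo (ωS h) (liftCLM ω h)) {h : H} {t : σ → Circle} (ht : ι h = diagHom t) (f : SR σ) :
    ωS h f = vacCoeff ω h • torusOpPi (torusAngle t) f :=
  hS.apply_eq_vacCoeff_smul_torusOpPi hlift (by rw [ht, torusPt_torusAngle]) f

/-- **The Hermite functions are weight vectors of every covariant family, ON `𝓢`**:
`ωS h (h_α) = (vacCoeff ω h · e^{iθ·α}) • h_α` for `ι h = diag (torusPt θ)`. [cite: Folland1989, §1.7] -/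
theorem IsRhoCovariantS.apply_hermitePi (hS : IsRhoCovariantS ι ωS)
    (hlift : ∀ h, LiftsTo (ωS h) (liftCLM ω h)) {h : H} {θ : σ → ℝ} (ht : ι h = diagHom (torusPt θ)) (α : σ →₀ ℕ) :
    ωS h (hermitePi α) = (vacCoeff ω h * torusPhase θ α) • hermitePi α := by
  rw [hS.apply_eq_vacCoeff_smul_torusOpPi hlift ht, torusOpPi_hermitePi, smul_smul]

/-- Torus-element form of `IsRhoCovariantS.apply_hermitePi`: `ωS h (h_α) = (vacCoeff ω h · torusChar α t) • h_α` for
`ι h = diag t`. [cite: Folland1989, §1.7] -/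
theorem IsRhoCovariantS.apply_hermitePi_of_diag (hS : IsRhoCovariantS ι ωS)
    (hlift : ∀ h, LiftsTo (ωS h) (liftCLM ω h)) {h : H} {t : σ → Circle} (ht : ι h = diagHom t) (α : σ →₀ ℕ) :
    ωS h (hermitePi α) = (vacCoeff ω h * torusChar α t) • hermitePi α := by
  rw [hS.apply_eq_vacCoeff_smul_torusOpPi_torusAngle hlift ht, torusOpPi_hermitePi, smul_smul,
    ← torusChar_torusPt, torusPt_torusAngle]

/-- **Euclidean-carrier form of the rigidity**: for a family `ωD` on `𝓢(EuclideanSpace ℝ σ, ℂ)` covariant over `ι` in the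
sense of the carrier-transport file (`IsRhoCovariantSD euclE ι ωD`) whose transports lift to unitaries,
`ωD h g = vacCoeff ω h • e^{iθ·N} g` for every `g`. [cite: Folland1989, Prop (4.39)] -/
theorem IsRhoCovariantSD.apply_eq_vacCoeff_smul_torusOpCLM {ωD : H → ((SE σ) →ₗ[ℂ] SE σ)}
    (hD : IsRhoCovariantSD (euclE σ) ι ωD)
    (hlift : ∀ h, LiftsTo (opTransport (euclE σ) (ωD h)) (liftCLM ω h)) {h : H} {θ : σ → ℝ}
    (ht : ι h = diagHom (torusPt θ)) (g : SE σ) :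
    ωD h g = vacCoeff ω h • torusOpCLM θ g := by
  have hS : IsRhoCovariantS ι (fun h => opTransport (euclE σ) (ωD h)) :=
    (isRhoCovariantS_opTransport_iff (euclE σ) ι ωD).2 hD
  have h1 := hS.apply_eq_vacCoeff_smul_torusOpPi hlift ht (schwartzTransport (euclE σ) g)
  rw [opTransport_apply, ContinuousLinearEquiv.symm_apply_apply, torusOpPi_apply,
    ContinuousLinearEquiv.symm_apply_apply, ← map_smul] at h1
  exact (schwartzTransport (euclE σ)).injective h1

/-- … and on the Hermite functions of the Euclidean carrier: `ωD h (hermiteSchwartz (herm α)) =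
(vacCoeff ω h · e^{iθ·α}) • hermiteSchwartz (herm α)`. [cite: Folland1989, §1.7] -/
theorem IsRhoCovariantSD.apply_hermiteSchwartz {ωD : H → ((SE σ) →ₗ[ℂ] SE σ)}
    (hD : IsRhoCovariantSD (euclE σ) ι ωD)
    (hlift : ∀ h, LiftsTo (opTransport (euclE σ) (ωD h)) (liftCLM ω h)) {h : H} {θ : σ → ℝ}
    (ht : ι h = diagHom (torusPt θ)) (α : σ →₀ ℕ) :
    ωD h (hermiteSchwartz (herm α)) = (vacCoeff ω h * torusPhase θ α) • hermiteSchwartz (herm α) := by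
  rw [hD.apply_eq_vacCoeff_smul_torusOpCLM hlift ht, torusOpCLM_herm, smul_smul]

end Rigidity

/-! ## §5  Consequences from the analysis lane: continuity and the generator, on the Folland carrier -/

section Analysis

/-- **Strong continuity of the torus on `𝓢(ℝ^σ, ℂ)`**: `θ ↦ torusOpPi θ f` is continuous into the Schwartz topology
(tree `continuous_torusOpCLM_apply`, transported). [cite: Folland1989, §1.7] -/
theorem continuous_torusOpPi_apply (f : SR σ) : Continuous fun θ : σ → ℝ => torusOpPi θ f :=
  (schwartzTransport (euclE σ)).continuous.comp (continuous_torusOpCLM_apply ((schwartzTransport (euclE σ)).symm f))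

/-- Joint continuity `(θ, f) ↦ torusOpPi θ f`. [cite: Folland1989, §1.7] -/
theorem continuous_torusOpPi_uncurry : Continuous fun p : (σ → ℝ) × (SR σ) => torusOpPi p.1 p.2 := by
  have h1 : Continuous fun p : (σ → ℝ) × (SR σ) => (p.1, (schwartzTransport (euclE σ)).symm p.2) :=
    continuous_fst.prodMk ((schwartzTransport (euclE σ)).symm.continuous.comp continuous_snd)
  have h2 : Continuous fun p : (σ → ℝ) × (SR σ) => torusOpCLM p.1 ((schwartzTransport (euclE σ)).symm p.2) :=
    continuous_torusOpCLM_uncurry.comp (f := fun p : (σ → ℝ) × (SR σ) => (p.1, (schwartzTransport (euclE σ)).symm p.2)) h1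
  have h3 : Continuous fun p : (σ → ℝ) × (SR σ) =>
      schwartzTransport (euclE σ) (torusOpCLM p.1 ((schwartzTransport (euclE σ)).symm p.2)) :=
    (schwartzTransport (euclE σ)).continuous.comp
      (f := fun p : (σ → ℝ) × (SR σ) => torusOpCLM p.1 ((schwartzTransport (euclE σ)).symm p.2)) h2
  simpa only [torusOpPi_apply] using h3

/-- `torusOpPi θ f → f` as `θ → 0`. [folklore] -/
theorem tendsto_torusOpPi_zero (f : SR σ) : Tendsto (fun θ : σ → ℝ => torusOpPi θ f) (𝓝 0) (𝓝 f) := by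
  have h := (continuous_torusOpPi_apply f).tendsto (0 : σ → ℝ)
  rwa [torusOpPi_zero, ContinuousLinearMap.id_apply] at h

/-- **The generator of the one-parameter subgroup `t ↦ torusOpPi (t v)` at `t = 0`**: the difference quotients
`t⁻¹ (torusOpPi (t v) f − f)` converge IN `𝓢(ℝ^σ, ℂ)` to the transport of the Hermite multiplier `i (v·β)` (tree
`tendsto_slope_torusOpCLM_zero`). [cite: Folland1989, §1.7] -/
theorem tendsto_slope_torusOpPi_zero (v : σ → ℝ) (f : SR σ) :
    Tendsto (fun t : ℝ => t⁻¹ • (torusOpPi (t • v) f - f)) (𝓝[≠] 0)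
      (𝓝 (schwartzTransport (euclE σ)
        (hermiteMultiplierCLM (fun β => I * torusGenMult v β) (isPolyBounded_I_mul_torusGenMult v)
          ((schwartzTransport (euclE σ)).symm f)))) := by
  set φ := (schwartzTransport (euclE σ)).symm f with hφ
  have h := (((schwartzTransport (euclE σ) : (SE σ) →L[ℂ] SR σ).continuous.tendsto _).comp
    (tendsto_slope_torusOpCLM_zero v φ))
  refine h.congr fun t => ?_
  show (schwartzTransport (euclE σ) : (SE σ) →L[ℂ] SR σ) (t⁻¹ • (torusOpCLM (t • v) φ - φ)) = _
  rw [ContinuousLinearMap.map_smul_of_tower, map_sub]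
  simp only [ContinuousLinearEquiv.coe_coe, torusOpPi_apply, hφ, ContinuousLinearEquiv.apply_symm_apply]

/-- **The diagonal subgroup**: `t⁻¹ (torusOpPi (t,…,t) f − f) → i • (e^* N (e^*)⁻¹) f` IN `𝓢(ℝ^σ, ℂ)` — the number
operator is the generator of `t ↦ e^{itN}` on the Folland carrier (tree `tendsto_slope_torusOpCLM_diag`, transported).
[cite: Folland1989, §1.7] -/
theorem tendsto_slope_torusOpPi_diag (f : SR σ) :
    Tendsto (fun t : ℝ => t⁻¹ • (torusOpPi (fun _ : σ => t) f - f)) (𝓝[≠] 0)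
      (𝓝 ((I : ℂ) • schwartzTransport (euclE σ) (numberOpCLM ((schwartzTransport (euclE σ)).symm f)))) := by
  set φ := (schwartzTransport (euclE σ)).symm f with hφ
  have h := (((schwartzTransport (euclE σ) : (SE σ) →L[ℂ] SR σ).continuous.tendsto _).comp
    (tendsto_slope_torusOpCLM_diag φ))
  rw [ContinuousLinearEquiv.coe_coe, map_smul] at h
  refine h.congr fun t => ?_
  show (schwartzTransport (euclE σ) : (SE σ) →L[ℂ] SR σ) (t⁻¹ • (torusOpCLM (fun _ : σ => t) φ - φ)) = _
  rw [ContinuousLinearMap.map_smul_of_tower, map_sub]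
  simp only [ContinuousLinearEquiv.coe_coe, torusOpPi_apply, hφ, ContinuousLinearEquiv.apply_symm_apply]

end Analysis

end Literature.Analysis.SegalBargmann
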